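import Literature.NumberTheory.LFunctions.AutomaticSequenceTransducerArith6
import HarnessLib

/-!
# Arithmetic restrictions for the naturally induced transducer, VII: residues of paths between arbitrary states and the homomorphism `s₀` (Müllner 2017, Prop. 2.23 / Thm. 2.16; proved)

Everything in this file is PROVED (plus one plain definition). Continuing §2.4 of C. Müllner,
*Automatic sequences fulfill the Sarnak conjecture* (Duke Math. J. 166 (2017)):

* `MinImage.s0Hom` — `s₀ : G_M →* Multiplicative (ZMod d')`, the homomorphism of
  `AutomaticSequenceTransducerArith6.lean` bundled (`s0_trans`, `s0_one`); Müllner's `G₀` is its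
  kernel (Cor. 2.24) and the fibres `{g : s₀(g) = t}` are its cosets (Thm. 2.16 (1)).
* **Prop. 2.23 with explicit normalisation constants** (`MinImage.natCast_wordVal_path`): fix
  digit paths `p : M₀ → M`, `q : M' → M₀` of lengths `P d`, `Q d` (`P, Q ≥ ℓ*`); then for EVERY
  digit path `w : M → M'` of length `ℓ d`,
  `[w]_k ≡ s₀(T(p) ≫ T(M,w) ≫ T(q)) + (P + ℓ + Q) • a − [p]_k − [q]_k (mod d')` — the residue of
  `w` depends only on its output `T(M, w)` and on `ℓ` (through `ℓ • a`, i.e. on `ℓ mod k₀`), which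
  is Prop. 2.23; Müllner's second relabelling (Lemma 2.22) is the choice of labels and connecting
  paths making the constants vanish. `exists_connecting_paths` supplies admissible `p, q`.
* `MinImage.natCast_wordVal_sub_of_same_output` — two paths `M → M'` with the same output and
  lengths `ℓ₁ d, ℓ₂ d` have `[w₁]_k − [w₂]_k ≡ (ℓ₁ − ℓ₂) • a`.

## References
* C. Müllner, Duke Math. J. 166 (2017), §2.4: Lemma 2.22, Prop. 2.23, Cor. 2.24, Thm. 2.16. [Mullner2017]
-/

noncomputable section

open Finset

namespace Literature.NumberTheory.LFunctions

namespace MinImage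

variable {σ : Type*} [Fintype σ] [DecidableEq σ] {δ : σ → ℕ → σ} {k : ℕ}

/-- **`s₀` as a group homomorphism `G_M →* Multiplicative (ZMod d')`** (Cor. 2.24: `G₀ = ker s₀`).
[cite: Mullner2017, Cor. 2.24] -/
def s0Hom (hk : 2 ≤ k) (htriv : ∀ q d, k ≤ d → δ q d = q) (M : MinImage δ) :
    M.loopGroup (by omega : 0 < k) htriv →* Multiplicative (ZMod (transducerDPrime hk δ htriv)) where
  toFun g := Multiplicative.ofAdd (M.s0 hk htriv g.1)
  map_one' := by
    show Multiplicative.ofAdd (M.s0 hk htriv (1 : M.loopGroup (by omega : 0 < k) htriv).1) = 1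
    rw [Subgroup.coe_one, s0_one]
    rfl
  map_mul' g h := by
    show Multiplicative.ofAdd (M.s0 hk htriv (g * h).1) =
      Multiplicative.ofAdd (M.s0 hk htriv g.1) * Multiplicative.ofAdd (M.s0 hk htriv h.1)
    rw [← ofAdd_add, Subgroup.coe_mul, Equiv.Perm.mul_def, M.s0_trans hk htriv h.2 g.2, add_comm]

/-- The value of `s0Hom`. [folklore] -/
theorem s0Hom_apply (hk : 2 ≤ k) (htriv : ∀ q d, k ≤ d → δ q d = q) (M : MinImage δ)
    (g : M.loopGroup (by omega : 0 < k) htriv) :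
    M.s0Hom hk htriv g = Multiplicative.ofAdd (M.s0 hk htriv g.1) := rfl

/-- **Connecting paths of class `0` and large length** exist between any two states. [folklore] -/
theorem exists_connecting_paths (hk : 2 ≤ k) (htriv : ∀ q d, k ≤ d → δ q d = q) (M N : MinImage δ)
    (L : ℕ) : ∃ p : List ℕ, ∃ P : ℕ, (∀ d ∈ p, d < k) ∧ p.length = P * transducerPeriod k δ ∧
      M.next p = N ∧ L ≤ P := by
  have hk0 : 0 < k := by omega
  have hd := transducerPeriod_pos hk0 htriv (δ := δ)
  obtain ⟨N₀, hN₀⟩ := exists_forall_exists_next_eq hk0 htriv (δ := δ)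
  obtain ⟨p, hpd, hpl, hpn⟩ := hN₀ M N (max N₀ L * transducerPeriod k δ)
    ((le_max_left _ _).trans (Nat.le_mul_of_pos_right _ hd))
  exact ⟨p, max N₀ L, hpd, hpl, hpn, le_max_right _ _⟩

/-- **Müllner 2017, Prop. 2.23 (with explicit normalisation constants)**: for fixed connecting digit
paths `p : M₀ → M` and `q : M' → M₀` of lengths `P d`, `Q d` with `P, Q ≥ ℓ*`, every digit path
`w : M → M'` of length `ℓ d` satisfies
`[w]_k ≡ s₀(T(M₀,p) ≫ T(M,w) ≫ T(M',q)) + (P + ℓ + Q) • a − [p]_k − [q]_k (mod d')`.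
[cite: Mullner2017, Prop. 2.23] -/
theorem natCast_wordVal_path (hk : 2 ≤ k) (htriv : ∀ q d, k ≤ d → δ q d = q) {M₀ M M' : MinImage δ}
    {p : List ℕ} (hpd : ∀ d ∈ p, d < k) {P : ℕ} (hpl : p.length = P * transducerPeriod k δ)
    (hpn : M₀.next p = M) (hP : s0Level hk htriv (δ := δ) ≤ P)
    {q : List ℕ} (hqd : ∀ d ∈ q, d < k) {Q : ℕ} (hql : q.length = Q * transducerPeriod k δ)
    (hqn : M'.next q = M₀)
    {w : List ℕ} (hwd : ∀ d ∈ w, d < k) {ℓ : ℕ} (hwl : w.length = ℓ * transducerPeriod k δ)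
    (hwn : M.next w = M') :
    ((wordVal k w : ℕ) : ZMod (transducerDPrime hk δ htriv)) =
      M₀.s0 hk htriv ((M₀.T p).trans ((M.T w).trans (M'.T q))) + (P + ℓ + Q) • s0Slope hk htriv -
        wordVal k p - wordVal k q := by
  have hloop := M₀.natCast_wordVal_loop hk htriv (w := p ++ w ++ q)
    (digits_append (digits_append hpd hwd) hqd) (ℓ := P + ℓ + Q)
    (by rw [List.length_append, List.length_append, hpl, hwl, hql]; ring)
    (by rw [next_append, next_append, hpn, hwn, hqn]) (hP.trans (by omega))
  rw [natCast_wordVal_conj hk htriv (by rw [hwl]; exact dvd_mul_left _ _)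
    (by rw [hql]; exact dvd_mul_left _ _), T_append, T_append, next_append, hpn, hwn,
    Equiv.trans_assoc] at hloop
  linear_combination hloop

/-- **Two paths with the same endpoints and output**: `[w₁]_k − [w₂]_k ≡ ℓ₁ • a − ℓ₂ • a (mod d')`
for digit paths `M → M'` of lengths `ℓ₁ d`, `ℓ₂ d` with `T(M, w₁) = T(M, w₂)` (so the residue
depends only on the output and on `ℓ mod k₀`). [cite: Mullner2017, Prop. 2.23] -/
theorem natCast_wordVal_sub_of_same_output (hk : 2 ≤ k) (htriv : ∀ q d, k ≤ d → δ q d = q)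
    {M M' : MinImage δ} {w₁ w₂ : List ℕ} (h₁d : ∀ d ∈ w₁, d < k) (h₂d : ∀ d ∈ w₂, d < k)
    {ℓ₁ ℓ₂ : ℕ} (h₁l : w₁.length = ℓ₁ * transducerPeriod k δ) (h₂l : w₂.length = ℓ₂ * transducerPeriod k δ)
    (h₁n : M.next w₁ = M') (h₂n : M.next w₂ = M') (hT : M.T w₁ = M.T w₂) :
    ((wordVal k w₁ : ℕ) : ZMod (transducerDPrime hk δ htriv)) - wordVal k w₂ =
      ℓ₁ • s0Slope hk htriv - ℓ₂ • s0Slope hk htriv := by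
  obtain ⟨p, P, hpd, hpl, hpn, hP⟩ := exists_connecting_paths hk htriv (transducerBase δ) M
    (s0Level hk htriv (δ := δ))
  obtain ⟨q, Q, hqd, hql, hqn, -⟩ := exists_connecting_paths hk htriv M' (transducerBase δ) 0
  have e1 := natCast_wordVal_path hk htriv hpd hpl hpn hP hqd hql hqn h₁d h₁l h₁n
  have e2 := natCast_wordVal_path hk htriv hpd hpl hpn hP hqd hql hqn h₂d h₂l h₂n
  rw [hT] at e1
  rw [e1, e2, add_nsmul, add_nsmul, add_nsmul, add_nsmul]
  ring

end MinImage

end Literature.NumberTheory.LFunctions
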